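import Summits.FinalStateConjecture.FinalStateConjecture.Theorems.ParametricKerrBurial.Negative.GeneralSpinAxis
import Literature.Geometry.Lorentzian.TrivialDataAdmissible
import Literature.Geometry.Lorentzian.PseudoRiemannianMetricProofs
import Literature.Geometry.Lorentzian.ChartSecondFundamentalForm

/-!
# Negative lemmas for the crux `SwallowTheDatum.ParametricKerrBurial`, IV — every Kerr shield, of
# ANY spin, has `k ≠ 0` at the axis point; the guard `c ≠ 0` of the crux is load-bearing

Support file (refuter, cdisprove seat of `stmt-FinalStateConjecture-10052`, cycle 3; everything
proved, no definitions, no named facts), continuing `GeneralSpinAxis.lean`. The crux's `c ≠ 0`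
members are KERR-SHIELDED: outside a compact set, the exact graph `t* = T(r)` (`T ≡ 0` on
`r ≤ 4M`) over the Kerr–Schild slice `{r > r₁}`, `r₁ < r₊`, of a sub-extremal Kerr `(M, a)`.
Parts I–II treated `a = 0`; here, for ANY spin:

* on the unbent zone the graph is the slice embedding and the future unit normal is FORCED to be
  `V/√(1 + 2H)` (`spin_nu_eq_normalRep`); `spin_sff_eq_half_of_repr`, `spin_sff_axisPt` — the typed
  `secondFundamentalForm` in the `½(∂g)` form and, at the axis point `(0, 0, u)`, in CLOSED FORM
  `K(e_z, e_z) = −2H_ax′(u)(1 + H_ax(u))/√(1 + 2H_ax(u))`, `H_ax(u) = Mu/(u² + a²)`;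
* `k_pullback_axisPt`, `axisTooth_pos` — **the axis tooth**: at `y₀ = (0, 0, 3M)` (inside every
  shield's unbent zone, `axisPt_mem_slice`) `k_{φ y₀}(dφ e_z, dφ e_z) > 0` for all `|a| < M`
  (`H_ax′(3M) = M(a² − 9M²)/(9M² + a²)² < 0`);
* `exists_k_ne_zero_of_spinShield` — every shield of every spin forces `k ≢ 0`;
  `not_kerrShielded_of_isTimeSymmetric` — the crux's shielding conjunct (verbatim) fails for every
  time-symmetric datum (flat data, Schwarzschild/Brill–Lindquist/Misner slices, Brill waves);
* `parametricKerrBurial_false_without_ne_zero` — **LOAD-BEARING `c ≠ 0`**: the crux with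
  `∀ c ≠ 0` replaced by `∀ c` is false (witness `Minkowski.slice`, `trivialData`); any proof must
  use the exception at `c = 0`, i.e. the family must genuinely move off the datum.

References: G. B. Cook, Living Rev. Relativ. 3 (2000) 5, §3.2.2 (55)–(57) [Cook2000];
B. O'Neill, *Semi-Riemannian geometry* (1983), Ch. 4, Lemmas 4.1, 4.4 [ONeill1983];
D. Christodoulou, CQG 16 (1999) A23, p. A24 (families of data) [Christodoulou1999].
-/

noncomputable section

-- instance search through nested operator types `E4 →L E4 →L E4 →L ℝ` (as in the tree files)
set_option maxSynthPendingDepth 3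
-- `Summit.<S>.<S>.…` by design (D-0017; the Summits lakefile turns this linter off as well)
set_option linter.dupNamespace false

namespace Summit.FinalStateConjecture.FinalStateConjecture.Theorems.ParametricKerrBurial.Negative

open Literature.Geometry.Lorentzian
open scoped Manifold ContDiff Topology InnerProductSpace
open Set Filter

/-- The spatial unit vector `e_z ∈ E3` (local notation). -/
local notation "e_z" => (EuclideanSpace.single (2 : Fin 3) (1 : ℝ) : E3)

/-- The constant axis covector `ℓ₀ = dt* + dz` (local notation). -/
local notation "ℓ₀" => (E4.covector ![(1 : ℝ), 0, 0, 1])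

/-- The representative `y ↦ (1 + 2H(0,y))^{-1/2} V(0, y)` of the future unit normal of the
Kerr–Schild slice `{t* = 0}` of Kerr `(M, a)` (local notation; Cook 2000, §3.2.2). -/
local notation "νKS[" M ", " a "]" => (fun y : E3 ↦
  (√(1 + 2 * Kerr.scalarH M a (E4.ofTimeSpace 0 y)))⁻¹ • Kerr.timeVector M a (E4.ofTimeSpace 0 y))

/-! ### The graph of a height vanishing on the unbent zone `{r < 4M}`, general spin -/

/-- On `{r(a, (0, z)) < 4M}` the graph representative of a height `T` with `T ≡ 0` on `r ≤ 4M` is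
the flat slice embedding `z ↦ (0, z)`, locally (the zone is open by continuity of `r`). [folklore] -/
theorem spinGraphRep_eventuallyEq {M a : ℝ} {T : ℝ → ℝ} (hT0 : ∀ r, r ≤ 4 * M → T r = 0)
    {z : E3} (hz : Kerr.radius a (E4.ofTimeSpace 0 z) < 4 * M) :
    (fun z : E3 ↦ E4.ofTimeSpace (T (Kerr.radius a (E4.ofTimeSpace 0 z))) z) =ᶠ[𝓝 z]
      E4.ofTimeSpace 0 := by
  have ho : IsOpen {z : E3 | Kerr.radius a (E4.ofTimeSpace 0 z) < 4 * M} :=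
    isOpen_lt ((Kerr.continuous_radius a).comp (E4.continuous_ofTimeSpace 0)) continuous_const
  filter_upwards [ho.mem_nhds hz] with u hu
  rw [hT0 _ (le_of_lt hu)]

/-- The graph representative is differentiable on the unbent zone. [folklore] -/
theorem differentiableAt_spinGraphRep {M a : ℝ} {T : ℝ → ℝ} (hT0 : ∀ r, r ≤ 4 * M → T r = 0)
    {z : E3} (hz : Kerr.radius a (E4.ofTimeSpace 0 z) < 4 * M) :
    DifferentiableAt ℝ (fun z : E3 ↦ E4.ofTimeSpace (T (Kerr.radius a (E4.ofTimeSpace 0 z))) z) z :=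
  (Kerr.hasFDerivAt_ofTimeSpace_zero z).differentiableAt.congr_of_eventuallyEq
    (spinGraphRep_eventuallyEq hT0 hz)

/-- The differential of the graph representative on the unbent zone is `v ↦ (0, v)`. [folklore] -/
theorem fderiv_spinGraphRep {M a : ℝ} {T : ℝ → ℝ} (hT0 : ∀ r, r ≤ 4 * M → T r = 0)
    {z : E3} (hz : Kerr.radius a (E4.ofTimeSpace 0 z) < 4 * M) (v : E3) :
    fderiv ℝ (fun z : E3 ↦ E4.ofTimeSpace (T (Kerr.radius a (E4.ofTimeSpace 0 z))) z) z v =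
      E4.ofTimeSpace 0 v := by
  rw [(spinGraphRep_eventuallyEq hT0 hz).fderiv_eq, Kerr.fderiv_ofTimeSpace_zero]

/-- Points of the slice have positive Kerr–Schild radius. [folklore] -/
theorem radius_pos_of_mem_slice {a r₁ : ℝ} (y : Kerr.slice a r₁) :
    0 < Kerr.radius a (E4.ofTimeSpace 0 (y : E3)) :=
  lt_of_le_of_lt (le_max_right _ _) (Kerr.mem_slice.1 y.2)

/-- On the unbent zone the graph `ψ` IS the Kerr–Schild slice embedding (any spin). [folklore] -/
theorem spin_psi_eq_sliceEmbed {M a r₁ : ℝ} {T : ℝ → ℝ} (hT0 : ∀ r, r ≤ 4 * M → T r = 0)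
    {ψ : Kerr.slice a r₁ → Kerr.region a r₁}
    (hψ : ∀ y : Kerr.slice a r₁, (ψ y : E4) =
      E4.ofTimeSpace (T (Kerr.radius a (E4.ofTimeSpace 0 (y : E3)))) (y : E3))
    {y : Kerr.slice a r₁} (hy4 : Kerr.radius a (E4.ofTimeSpace 0 (y : E3)) < 4 * M) :
    ψ y = Kerr.sliceEmbed a r₁ y := by
  apply Subtype.ext
  rw [hψ y, Kerr.coe_sliceEmbed]
  exact (spinGraphRep_eventuallyEq hT0 hy4).self_of_nhds

/-- … and its differential is `v ↦ (0, v)`. [folklore] -/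
theorem spin_mfderiv_psi {M a r₁ : ℝ} {T : ℝ → ℝ} (hT0 : ∀ r, r ≤ 4 * M → T r = 0)
    {ψ : Kerr.slice a r₁ → Kerr.region a r₁}
    (hψ : ∀ y : Kerr.slice a r₁, (ψ y : E4) =
      E4.ofTimeSpace (T (Kerr.radius a (E4.ofTimeSpace 0 (y : E3)))) (y : E3))
    {y : Kerr.slice a r₁} (hy4 : Kerr.radius a (E4.ofTimeSpace 0 (y : E3)) < 4 * M) (v : E3) :
    mfderiv 𝓘(ℝ, E3) 𝓘(ℝ, E4) ψ y v = E4.ofTimeSpace 0 v := by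
  rw [OpensChart.mfderiv_apply_of_repr
    (Φ := fun z : E3 ↦ E4.ofTimeSpace (T (Kerr.radius a (E4.ofTimeSpace 0 z))) z) hψ
    (differentiableAt_spinGraphRep hT0 hy4), fderiv_spinGraphRep hT0 hy4]

/-- **On the unbent zone the future unit normal of a shield of ANY spin IS `V/√(1 + 2H)`**
(uniqueness `eq_normalRepA` of part III). [cite: Cook2000, §3.2.2] -/
theorem spin_nu_eq_normalRep [Kerr.Facts] {M a r₁ : ℝ} (hM : 0 ≤ M) {T : ℝ → ℝ}
    (hT0 : ∀ r, r ≤ 4 * M → T r = 0)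
    {ψ : Kerr.slice a r₁ → Kerr.region a r₁} {ν : NormalField 𝓘(ℝ, E4) ψ}
    (hψ : ∀ y : Kerr.slice a r₁, (ψ y : E4) =
      E4.ofTimeSpace (T (Kerr.radius a (E4.ofTimeSpace 0 (y : E3)))) (y : E3))
    (hν : (Kerr.smoothMetric M a r₁).IsFutureUnitNormal 𝓘(ℝ, E3)
      ((Kerr.timeOrientation M a r₁ hM).ofLE le_top) ψ ν)
    {y : Kerr.slice a r₁} (hy4 : Kerr.radius a (E4.ofTimeSpace 0 (y : E3)) < 4 * M) :
    ν y = (√(1 + 2 * Kerr.scalarH M a (E4.ofTimeSpace 0 (y : E3))))⁻¹ •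
      Kerr.timeVector M a (E4.ofTimeSpace 0 (y : E3)) := by
  have hx := radius_pos_of_mem_slice y
  have hψy : (ψ y : E4) = E4.ofTimeSpace 0 y := by
    rw [spin_psi_eq_sliceEmbed hT0 hψ hy4, Kerr.coe_sliceEmbed]
  have h1 : ∀ w : E3, Kerr.bilin M a (E4.ofTimeSpace 0 y) (ν y) (E4.ofTimeSpace 0 w) = 0 := by
    intro w
    have := hν.1.1 y w
    rw [spin_mfderiv_psi hT0 hψ hy4] at this
    rw [← hψy]
    exact this
  have h2 : Kerr.bilin M a (E4.ofTimeSpace 0 y) (ν y) (ν y) = -1 := by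
    rw [← hψy]; exact hν.1.2 y
  have h3 : Kerr.bilin M a (E4.ofTimeSpace 0 y)
      (Kerr.timeVector M a (E4.ofTimeSpace 0 y)) (ν y) < 0 := by
    rw [← hψy]; exact (hν.2 y).2
  exact eq_normalRepA hM hx h1 h2 h3

/-! ### The second fundamental form of a shield of any spin at the axis test point -/

/-- Second fundamental form of a map `f : slice a r₁ → region a r₁` with field `ν` at a point
where `(f, ν)` has representatives tangent to the unbent Kerr–Schild slice to first order: the
`½ (∂g)` form, any spin (the normal-derivative term is eliminated by `bilin_fderiv_normalRepA`).
[cite: ONeill1983, Ch. 4, Lemma 4.4] -/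
theorem spin_sff_eq_half_of_repr [Kerr.Facts] {M a r₁ : ℝ} (hM : 0 ≤ M)
    [(Kerr.smoothMetric M a r₁).HasLeviCivita]
    {f : Kerr.slice a r₁ → Kerr.region a r₁} {Φ : E3 → E4} (hf : ∀ y, (f y : E4) = Φ y)
    {ν : NormalField 𝓘(ℝ, E4) f} {N : E3 → E4} (hν : ∀ y, ν y = N y)
    {y : Kerr.slice a r₁} (hΦd : DifferentiableAt ℝ Φ y) (hNd : DifferentiableAt ℝ N y)
    (hfy : f y = Kerr.sliceEmbed a r₁ y)
    (hΦ' : ∀ v : E3, fderiv ℝ Φ y v = E4.ofTimeSpace 0 v)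
    (hNy : N y = (√(1 + 2 * Kerr.scalarH M a (E4.ofTimeSpace 0 (y : E3))))⁻¹ •
      Kerr.timeVector M a (E4.ofTimeSpace 0 (y : E3)))
    (hN' : fderiv ℝ N y = fderiv ℝ νKS[M, a] y) (v w : E3) :
    (Kerr.smoothMetric M a r₁).secondFundamentalForm 𝓘(ℝ, E3) f ν y v w =
      2⁻¹ * (fderiv ℝ (Kerr.bilin M a) (E4.ofTimeSpace 0 y)
            ((√(1 + 2 * Kerr.scalarH M a (E4.ofTimeSpace 0 (y : E3))))⁻¹ •
              Kerr.timeVector M a (E4.ofTimeSpace 0 (y : E3)))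
            (E4.ofTimeSpace 0 w) (E4.ofTimeSpace 0 v)
          - fderiv ℝ (Kerr.bilin M a) (E4.ofTimeSpace 0 y) (E4.ofTimeSpace 0 v)
            ((√(1 + 2 * Kerr.scalarH M a (E4.ofTimeSpace 0 (y : E3))))⁻¹ •
              Kerr.timeVector M a (E4.ofTimeSpace 0 (y : E3))) (E4.ofTimeSpace 0 w)
          - fderiv ℝ (Kerr.bilin M a) (E4.ofTimeSpace 0 y) (E4.ofTimeSpace 0 w)
            (E4.ofTimeSpace 0 v)
            ((√(1 + 2 * Kerr.scalarH M a (E4.ofTimeSpace 0 (y : E3))))⁻¹ •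
              Kerr.timeVector M a (E4.ofTimeSpace 0 (y : E3)))) := by
  have hx := radius_pos_of_mem_slice y
  rw [OpensChart.secondFundamentalForm_eq_of_repr
    (g := (Kerr.smoothMetric M a r₁).toPseudoRiemannianMetric)
    (G := Kerr.bilin M a) (Kerr.smoothMetric_val M a r₁) hf hν hΦd hNd
    (Kerr.differentiableAt_bilin M a _) v w, hN', hNy, hΦ', hΦ', hfy]
  have hΓ := OpensChart.val_christoffel_const
    (g := (Kerr.smoothMetric M a r₁).toPseudoRiemannianMetric)
    (G := Kerr.bilin M a) (Kerr.sliceEmbed a r₁ y)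
    ((√(1 + 2 * Kerr.scalarH M a (E4.ofTimeSpace 0 (y : E3))))⁻¹ •
      Kerr.timeVector M a (E4.ofTimeSpace 0 (y : E3)))
    (E4.ofTimeSpace 0 v) (E4.ofTimeSpace 0 w)
  have hΓ' : Kerr.bilin M a (E4.ofTimeSpace 0 y) (OpensChart.christoffel
      (Kerr.smoothMetric M a r₁).toPseudoRiemannianMetric (Kerr.bilin M a)
      (Kerr.sliceEmbed a r₁ y)
      ((√(1 + 2 * Kerr.scalarH M a (E4.ofTimeSpace 0 (y : E3))))⁻¹ •
        Kerr.timeVector M a (E4.ofTimeSpace 0 (y : E3))) (E4.ofTimeSpace 0 v))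
      (E4.ofTimeSpace 0 w) =
      2⁻¹ * OpensChart.koszulForm (Kerr.bilin M a) (E4.ofTimeSpace 0 y)
        ((√(1 + 2 * Kerr.scalarH M a (E4.ofTimeSpace 0 (y : E3))))⁻¹ •
          Kerr.timeVector M a (E4.ofTimeSpace 0 (y : E3)))
        (E4.ofTimeSpace 0 v) (E4.ofTimeSpace 0 w) := hΓ
  show Kerr.bilin M a (E4.ofTimeSpace 0 y) (fderiv ℝ νKS[M, a] y v +
      OpensChart.christoffel (Kerr.smoothMetric M a r₁).toPseudoRiemannianMetric
      (Kerr.bilin M a) (Kerr.sliceEmbed a r₁ y)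
      ((√(1 + 2 * Kerr.scalarH M a (E4.ofTimeSpace 0 (y : E3))))⁻¹ •
        Kerr.timeVector M a (E4.ofTimeSpace 0 (y : E3)))
      (E4.ofTimeSpace 0 v)) (E4.ofTimeSpace 0 w) = _
  rw [map_add, _root_.add_apply, hΓ', OpensChart.koszulForm_apply,
    bilin_fderiv_normalRepA hM hx v w]
  ring

/-- **The second fundamental form at the axis test point `(0, 0, u)`, closed form (any spin)**:
`K(e_z, e_z) = −2 H_ax′(u) (1 + H_ax(u)) / √(1 + 2H_ax(u))`, `H_ax(u) = Mu/(u² + a²)`.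
[cite: Cook2000, §3.2.2 (57)] -/
theorem spin_sff_axisPt [Kerr.Facts] {M a r₁ : ℝ} (hM : 0 ≤ M)
    [(Kerr.smoothMetric M a r₁).HasLeviCivita]
    {f : Kerr.slice a r₁ → Kerr.region a r₁} {Φ : E3 → E4} (hf : ∀ y, (f y : E4) = Φ y)
    {ν : NormalField 𝓘(ℝ, E4) f} {N : E3 → E4} (hν : ∀ y, ν y = N y)
    {u : ℝ} (hu : 0 < u) {y : Kerr.slice a r₁} (hyu : (y : E3) = u • e_z)
    (hΦd : DifferentiableAt ℝ Φ y) (hNd : DifferentiableAt ℝ N y)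
    (hfy : f y = Kerr.sliceEmbed a r₁ y)
    (hΦ' : ∀ v : E3, fderiv ℝ Φ y v = E4.ofTimeSpace 0 v)
    (hNy : N y = (√(1 + 2 * Kerr.scalarH M a (E4.ofTimeSpace 0 (y : E3))))⁻¹ •
      Kerr.timeVector M a (E4.ofTimeSpace 0 (y : E3)))
    (hN' : fderiv ℝ N y = fderiv ℝ νKS[M, a] y) :
    (Kerr.smoothMetric M a r₁).secondFundamentalForm 𝓘(ℝ, E3) f ν y e_z e_z =
      -2 * (√(1 + 2 * (M * u / (u ^ 2 + a ^ 2))))⁻¹ *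
        (M * (a ^ 2 - u ^ 2) / (u ^ 2 + a ^ 2) ^ 2) * (1 + M * u / (u ^ 2 + a ^ 2)) := by
  rw [spin_sff_eq_half_of_repr hM hf hν hΦd hNd hfy hΦ' hNy hN' e_z e_z, hyu, ofTimeSpace_ez,
    normalRepA_axisPt M a hu]
  simp only [map_smul, map_sub, FunLike.coe_smul, FunLike.coe_sub,
    Pi.smul_apply, Pi.sub_apply, smul_eq_mul, fderiv_bilin_axis_Z M a hu,
    fderiv_bilin_axis_zero M a hu, E4.tmul_apply, ell0_basisVector_zero, ell0_basisVector_three,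
    zero_apply]
  ring

/-- The sign of the axis tooth: `H_ax′(3M) < 0` for sub-extremal parameters. [folklore] -/
theorem dHax_three_mul_neg {M a : ℝ} (haM : |a| < M) :
    M * (a ^ 2 - (3 * M) ^ 2) / ((3 * M) ^ 2 + a ^ 2) ^ 2 < 0 := by
  have hM : 0 < M := (abs_nonneg a).trans_lt haM
  have ha : a ^ 2 < M ^ 2 := sq_lt_sq' (abs_lt.1 haM).1 (abs_lt.1 haM).2
  have h1 : M * (a ^ 2 - (3 * M) ^ 2) < 0 := by nlinarith
  have h2 : 0 < ((3 * M) ^ 2 + a ^ 2) ^ 2 := by positivity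
  exact div_neg_of_neg_of_pos h1 h2

/-- **The axis tooth is POSITIVE**: `−2 H_ax′(3M)(1 + H)/√(1 + 2H) > 0`. [folklore] -/
theorem axisTooth_pos {M a : ℝ} (haM : |a| < M) :
    0 < -2 * (√(1 + 2 * (M * (3 * M) / ((3 * M) ^ 2 + a ^ 2))))⁻¹ *
      (M * (a ^ 2 - (3 * M) ^ 2) / ((3 * M) ^ 2 + a ^ 2) ^ 2) *
      (1 + M * (3 * M) / ((3 * M) ^ 2 + a ^ 2)) := by
  have hM : 0 < M := (abs_nonneg a).trans_lt haM
  have hH : 0 ≤ M * (3 * M) / ((3 * M) ^ 2 + a ^ 2) := by positivity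
  have hd : 0 < -(M * (a ^ 2 - (3 * M) ^ 2) / ((3 * M) ^ 2 + a ^ 2) ^ 2) :=
    neg_pos.2 (dHax_three_mul_neg haM)
  have hs : 0 < (√(1 + 2 * (M * (3 * M) / ((3 * M) ^ 2 + a ^ 2))))⁻¹ :=
    inv_pos.2 (Real.sqrt_pos.2 (by positivity))
  have : -2 * (√(1 + 2 * (M * (3 * M) / ((3 * M) ^ 2 + a ^ 2))))⁻¹ *
      (M * (a ^ 2 - (3 * M) ^ 2) / ((3 * M) ^ 2 + a ^ 2) ^ 2) *
      (1 + M * (3 * M) / ((3 * M) ^ 2 + a ^ 2)) =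
      2 * (√(1 + 2 * (M * (3 * M) / ((3 * M) ^ 2 + a ^ 2))))⁻¹ *
      (-(M * (a ^ 2 - (3 * M) ^ 2) / ((3 * M) ^ 2 + a ^ 2) ^ 2)) *
      (1 + M * (3 * M) / ((3 * M) ^ 2 + a ^ 2)) := by ring
  rw [this]
  positivity

/-- The axis test point `(0, 0, 3M)` lies in the slice `{r > r₁}` of every shield
(`r₁ < r₊ ≤ 2M < 3M = r(a, (0; 0, 0, 3M))`). [folklore] -/
theorem axisPt_mem_slice {M a r₁ : ℝ} (hM : 0 ≤ M) (haM : |a| < M) (hr₁ : r₁ < Kerr.rPlus M a) :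
    ((3 * M) • e_z) ∈ Kerr.slice a r₁ := by
  have hMpos : 0 < M := (abs_nonneg a).trans_lt haM
  rw [Kerr.mem_slice, radius_axisPt a 0 (by positivity : (0:ℝ) < 3 * M)]
  have hs : √(M ^ 2 - a ^ 2) ≤ M := by
    rw [Real.sqrt_le_left hM]
    nlinarith [sq_nonneg a]
  have : Kerr.rPlus M a ≤ 2 * M := by unfold Kerr.rPlus; linarith
  exact max_lt (by linarith) (by positivity)

open scoped Classical in
/-- **`k` of a Kerr-shielded datum at the axis test point (ANY spin)**: for a shield `(φ, ψ, ν)`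
of `D` with parameters `(M, a, r₁)`, height `T ≡ 0` on `r ≤ 4M`, and the axis point
`y₀ = (0, 0, 3M)` of the unbent zone: `k_{φ y₀}(dφ e_z, dφ e_z) = −2H′(1 + H)/√(1 + 2H)`,
`H = H_ax(3M) = 3M²/(9M² + a²)`, `H′ = H_ax′(3M) = M(a² − 9M²)/(9M² + a²)²`.
[cite: Cook2000, §3.2.2 (57)] -/
theorem k_pullback_axisPt [Kerr.Facts] {X : Type*} [TopologicalSpace X] [ChartedSpace E3 X]
    [IsManifold (𝓡 3) ∞ X] (D : InitialDataSet (𝓡 3) X) {M a r₁ : ℝ} (hM : 0 ≤ M)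
    (haM : |a| < M) (hr₁ : r₁ < Kerr.rPlus M a) {T : ℝ → ℝ} (hT0 : ∀ r, r ≤ 4 * M → T r = 0)
    {φ : Kerr.slice a r₁ → X} {ψ : Kerr.slice a r₁ → Kerr.region a r₁}
    {ν : NormalField 𝓘(ℝ, E4) ψ}
    (hψ : ∀ y : Kerr.slice a r₁, (ψ y : E4) =
      E4.ofTimeSpace (T (Kerr.radius a (E4.ofTimeSpace 0 (y : E3)))) (y : E3))
    (hν : (Kerr.smoothMetric M a r₁).IsFutureUnitNormal 𝓘(ℝ, E3)
      ((Kerr.timeOrientation M a r₁ hM).ofLE le_top) ψ ν)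
    (hk : ∀ [(Kerr.smoothMetric M a r₁).HasLeviCivita] (y : Kerr.slice a r₁),
      (pullbackBilin (I := 𝓡 3) (I' := 𝓘(ℝ, E3)) φ D.k y).toLinearMap₁₂ =
        (Kerr.smoothMetric M a r₁).secondFundamentalForm 𝓘(ℝ, E3) ψ ν y) :
    D.k (φ ⟨(3 * M) • e_z, axisPt_mem_slice hM haM hr₁⟩)
        (mfderiv 𝓘(ℝ, E3) (𝓡 3) φ ⟨(3 * M) • e_z, axisPt_mem_slice hM haM hr₁⟩ e_z)
        (mfderiv 𝓘(ℝ, E3) (𝓡 3) φ ⟨(3 * M) • e_z, axisPt_mem_slice hM haM hr₁⟩ e_z) =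
      -2 * (√(1 + 2 * (M * (3 * M) / ((3 * M) ^ 2 + a ^ 2))))⁻¹ *
        (M * (a ^ 2 - (3 * M) ^ 2) / ((3 * M) ^ 2 + a ^ 2) ^ 2) *
        (1 + M * (3 * M) / ((3 * M) ^ 2 + a ^ 2)) := by
  have hMpos : 0 < M := (abs_nonneg a).trans_lt haM
  have h3M : (0 : ℝ) < 3 * M := by positivity
  set y : Kerr.slice a r₁ := ⟨(3 * M) • e_z, axisPt_mem_slice hM haM hr₁⟩ with hydef
  have hyE : (y : E3) = (3 * M) • e_z := rfl
  have hy4 : Kerr.radius a (E4.ofTimeSpace 0 (y : E3)) < 4 * M := by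
    rw [hyE, radius_axisPt a 0 h3M]; linarith
  haveI : (Kerr.smoothMetric M a r₁).HasLeviCivita := PseudoRiemannianMetric.hasLeviCivita _
  -- global representatives of `ψ` and `ν`
  set N : E3 → E4 := fun z ↦ if hz : z ∈ Kerr.slice a r₁ then (ν ⟨z, hz⟩ : E4) else 0
    with hNdef
  have hνN : ∀ y : Kerr.slice a r₁, ν y = N y := fun y ↦ by
    simp only [hNdef, dif_pos y.2]
  have hNloc : N =ᶠ[𝓝 (y : E3)] νKS[M, a] := by
    have ho : IsOpen {z : E3 | z ∈ Kerr.slice a r₁ ∧ Kerr.radius a (E4.ofTimeSpace 0 z) < 4 * M} :=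
      (Kerr.slice a r₁).2.inter (isOpen_lt ((Kerr.continuous_radius a).comp
        (E4.continuous_ofTimeSpace 0)) continuous_const)
    filter_upwards [ho.mem_nhds ⟨y.2, hy4⟩] with z hz
    simp only [hNdef, dif_pos hz.1]
    exact spin_nu_eq_normalRep hM hT0 hψ hν (y := ⟨z, hz.1⟩) hz.2
  have hx := radius_pos_of_mem_slice y
  have hNd : DifferentiableAt ℝ N y :=
    (differentiableAt_normalRepA hM hx).congr_of_eventuallyEq hNloc
  have hN' : fderiv ℝ N y = fderiv ℝ νKS[M, a] y := hNloc.fderiv_eq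
  have hNy : N y = (√(1 + 2 * Kerr.scalarH M a (E4.ofTimeSpace 0 (y : E3))))⁻¹ •
      Kerr.timeVector M a (E4.ofTimeSpace 0 (y : E3)) := hNloc.self_of_nhds
  have e := LinearMap.congr_fun₂ (hk y) e_z e_z
  calc D.k (φ y) (mfderiv 𝓘(ℝ, E3) (𝓡 3) φ y e_z) (mfderiv 𝓘(ℝ, E3) (𝓡 3) φ y e_z)
      = (pullbackBilin (I := 𝓡 3) (I' := 𝓘(ℝ, E3)) φ D.k y).toLinearMap₁₂ e_z e_z := rfl
    _ = (Kerr.smoothMetric M a r₁).secondFundamentalForm 𝓘(ℝ, E3) ψ ν y e_z e_z := e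
    _ = _ := spin_sff_axisPt hM hψ hνN h3M hyE (differentiableAt_spinGraphRep hT0 hy4) hNd
          (spin_psi_eq_sliceEmbed hT0 hψ hy4) (fderiv_spinGraphRep hT0 hy4) hNy hN'

/-! ### TEETH of the typed shielding predicate, ANY spin -/

/-- **Every Kerr shield, of any sub-extremal spin, forces `k ≢ 0`**: a datum carrying a shield
`(φ, ψ, ν)` with parameters `(M, a, r₁)`, `|a| < M`, `r₁ < r₊`, and height `T ≡ 0` on `r ≤ 4M`
has `k ≠ 0` at the image of the axis test point. [cite: Cook2000, §3.2.2 (57)] -/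
theorem exists_k_ne_zero_of_spinShield [Kerr.Facts] {X : Type} [TopologicalSpace X]
    [ChartedSpace E3 X] [IsManifold (𝓡 3) ∞ X] (D : InitialDataSet (𝓡 3) X) {M a r₁ : ℝ}
    (hM : 0 ≤ M) (haM : |a| < M) (hr₁ : r₁ < Kerr.rPlus M a) {T : ℝ → ℝ}
    (hT0 : ∀ r, r ≤ 4 * M → T r = 0)
    {φ : Kerr.slice a r₁ → X} {ψ : Kerr.slice a r₁ → Kerr.region a r₁}
    {ν : NormalField 𝓘(ℝ, E4) ψ}
    (hψ : ∀ y : Kerr.slice a r₁, (ψ y : E4) =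
      E4.ofTimeSpace (T (Kerr.radius a (E4.ofTimeSpace 0 (y : E3)))) (y : E3))
    (hν : (Kerr.smoothMetric M a r₁).IsFutureUnitNormal 𝓘(ℝ, E3)
      ((Kerr.timeOrientation M a r₁ hM).ofLE le_top) ψ ν)
    (hk : ∀ [(Kerr.smoothMetric M a r₁).HasLeviCivita] (y : Kerr.slice a r₁),
      (pullbackBilin (I := 𝓡 3) (I' := 𝓘(ℝ, E3)) φ D.k y).toLinearMap₁₂ =
        (Kerr.smoothMetric M a r₁).secondFundamentalForm 𝓘(ℝ, E3) ψ ν y) :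
    ∃ x, D.k x ≠ 0 := by
  have key := k_pullback_axisPt D hM haM hr₁ hT0 hψ hν hk
  have hpos := axisTooth_pos haM
  refine ⟨φ ⟨(3 * M) • e_z, axisPt_mem_slice hM haM hr₁⟩, fun h0 ↦ ?_⟩
  rw [h0] at key
  have : (0 : ℝ) = -2 * (√(1 + 2 * (M * (3 * M) / ((3 * M) ^ 2 + a ^ 2))))⁻¹ *
      (M * (a ^ 2 - (3 * M) ^ 2) / ((3 * M) ^ 2 + a ^ 2) ^ 2) *
      (1 + M * (3 * M) / ((3 * M) ^ 2 + a ^ 2)) := by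
    rw [← key]; rfl
  linarith

/-- **The crux's verbatim height vanishes on the unbent zone, for every spin**
(`Real.smoothTransition` vanishes on `(-∞, 0]`; the `Real.log` junk below `r₊ < 4M` is multiplied
by an exact `0`), so every shield of `ParametricKerrBurial` satisfies the hypothesis `hT0` of the
lemmas of this file. [folklore] -/
theorem crux_spin_height_eq_zero {M a : ℝ} (hM : 0 < M) (r : ℝ) (hr : r ≤ 4 * M) :
    (fun r : ℝ => Real.smoothTransition (r / (4 * M) - 1) * (((M) / Real.sqrt ((M) ^ 2 - (a) ^ 2)) * (Literature.Geometry.Lorentzian.Kerr.rPlus M a * Real.log (r - Literature.Geometry.Lorentzian.Kerr.rPlus M a) - Literature.Geometry.Lorentzian.Kerr.rMinus M a * Real.log (r - Literature.Geometry.Lorentzian.Kerr.rMinus M a)) - ((M) / Real.sqrt ((M) ^ 2 - (a) ^ 2)) * (Literature.Geometry.Lorentzian.Kerr.rPlus M a * Real.log ((4 * M) - Literature.Geometry.Lorentzian.Kerr.rPlus M a) - Literature.Geometry.Lorentzian.Kerr.rMinus M a * Real.log ((4 * M) - Literature.Geometry.Lorentzian.Kerr.rMinus M a)))) r = 0 :=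 by
  have h4 : (0 : ℝ) < 4 * M := by positivity
  have : r / (4 * M) - 1 ≤ 0 := by
    rw [sub_nonpos, div_le_one h4]; exact hr
  simp only [Real.smoothTransition.zero_of_nonpos this, zero_mul]

/-- **No TIME-SYMMETRIC datum is Kerr-shielded, for any spin**: the shielding conjunct of the crux
`ParametricKerrBurial` (verbatim, `(F c)` replaced by `D`) fails for every datum with `k ≡ 0` —
flat data, the Schwarzschild / Brill–Lindquist / Misner slices, Brill waves.
[cite: Cook2000, §3.2.2 (57)] -/
theorem not_kerrShielded_of_isTimeSymmetric [Kerr.Facts] {X : Type} [TopologicalSpace X]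
    [ChartedSpace E3 X] [IsManifold (𝓡 3) ∞ X] {D : InitialDataSet (𝓡 3) X}
    (hD : D.IsTimeSymmetric) :
    ¬ (∃ (M a r₁ : ℝ) (hM : 0 ≤ M) (T : ℝ → ℝ) (φ : Literature.Geometry.Lorentzian.Kerr.slice a r₁ → X) (ψ : Literature.Geometry.Lorentzian.Kerr.slice a r₁ → Literature.Geometry.Lorentzian.Kerr.region a r₁) (ν : Literature.Geometry.Lorentzian.NormalField 𝓘(ℝ, Literature.Geometry.Lorentzian.E4) ψ), |a| < M ∧ Literature.Geometry.Lorentzian.Kerr.rMinus M a < r₁ ∧ r₁ < Literature.Geometry.Lorentzian.Kerr.rPlus M a ∧ T = (fun r : ℝ => Real.smoothTransition (r / (4 * M) - 1) * (((M) / Real.sqrt ((M) ^ 2 - (a) ^ 2)) * (Literature.Geometry.Lorentzian.Kerr.rPlus M a * Real.log (r - Literature.Geometry.Lorentzian.Kerr.rPlus M a) - Literature.Geometry.Lorentzian.Kerr.rMinus M a * Real.log (r - Literature.Geometry.Lorentzian.Kerr.rMinus M a)) - ((M) / Real.sqrt ((M) ^ 2 - (a) ^ 2)) * (Literature.Geometry.Lorentzian.Kerr.rPlus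 M a * Real.log ((4 * M) - Literature.Geometry.Lorentzian.Kerr.rPlus M a) - Literature.Geometry.Lorentzian.Kerr.rMinus M a * Real.log ((4 * M) - Literature.Geometry.Lorentzian.Kerr.rMinus M a)))) ∧ IsCompact (Set.range φ)ᶜ ∧ Topology.IsOpenEmbedding φ ∧ ContMDiff 𝓘(ℝ, Literature.Geometry.Lorentzian.E3) (𝓡 3) ((⊤ : ℕ∞) : WithTop ℕ∞) φ ∧ (∀ y : Literature.Geometry.Lorentzian.Kerr.slice a r₁, (ψ y : Literature.Geometry.Lorentzian.E4) = Literature.Geometry.Lorentzian.E4.ofTimeSpace (T (Literature.Geometry.Lorentzian.Kerr.radius a (Literature.Geometry.Lorentzian.E4.ofTimeSpace 0 (y : Literature.Geometry.Lorentzian.E3)))) (y : Literature.Geometry.Lorentzian.E3)) ∧ (Literature.Geometry.Lorentzian.Kerr.smoothMetric M a r₁).IsSpacelikeImmersion 𝓘(ℝ, Literature.Geometry.Lorentzian.E3) ψ ∧ (Literature.Geometry.Lorentzian.Kerr.smoothMetric M a r₁).IsFutureUnitNormal 𝓘(ℝ, Literature.Geometry.Lorentzian.E3) ((Literature.Geometry.Lorentzian.Kerr.timeOrientation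 M a r₁ hM).ofLE le_top) ψ ν ∧ (∀ y : Literature.Geometry.Lorentzian.Kerr.slice a r₁, Literature.Geometry.Lorentzian.pullbackBilin (I := 𝓡 3) (I' := 𝓘(ℝ, Literature.Geometry.Lorentzian.E3)) φ D.h.inner y = Literature.Geometry.Lorentzian.pullbackBilin (I := 𝓘(ℝ, Literature.Geometry.Lorentzian.E4)) (I' := 𝓘(ℝ, Literature.Geometry.Lorentzian.E3)) ψ (Literature.Geometry.Lorentzian.Kerr.smoothMetric M a r₁).val y) ∧ (∀ [(Literature.Geometry.Lorentzian.Kerr.smoothMetric M a r₁).HasLeviCivita] (y : Literature.Geometry.Lorentzian.Kerr.slice a r₁), (Literature.Geometry.Lorentzian.pullbackBilin (I := 𝓡 3) (I' := 𝓘(ℝ, Literature.Geometry.Lorentzian.E3)) φ D.k y).toLinearMap₁₂ = (Literature.Geometry.Lorentzian.Kerr.smoothMetric M a r₁).secondFundamentalForm 𝓘(ℝ, Literature.Geometry.Lorentzian.E3) ψ ν y)) := by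
  rintro ⟨M, a, r₁, hM, T, φ, ψ, ν, haM, -, hr₁, hT, -, -, -, hψ, -, hν, -, hk⟩
  have hMpos : 0 < M := (abs_nonneg a).trans_lt haM
  subst hT
  obtain ⟨x, hx⟩ := exists_k_ne_zero_of_spinShield D hM haM hr₁
    (crux_spin_height_eq_zero hMpos) hψ hν hk
  exact hx (hD x)

/-- **Any proof of the crux must use the guard `c ≠ 0`** (load-bearing analysis): the crux
`ParametricKerrBurial` with `∀ c ≠ 0` replaced by `∀ c` — every member shielded, including
`F 0 = d` — is FALSE: at `X = Minkowski.slice`, `d = trivialData` (admissible,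
`trivialData_mem_admissibleVacuumData`) the member `F 0 = d` is time-symmetric, hence
unshieldable for every spin. So a burial family must genuinely MOVE off `d`.
[cite: Christodoulou1999, p. A24] -/
theorem parametricKerrBurial_false_without_ne_zero :
    ¬ (∀ [Literature.Geometry.Lorentzian.Kerr.Facts] (X : Type) [TopologicalSpace X] [ChartedSpace Literature.Geometry.Lorentzian.E3 X] [IsManifold (𝓡 3) ((⊤ : ℕ∞) : WithTop ℕ∞) X] [T2Space X] [SecondCountableTopology X] [ConnectedSpace X], ∀ d ∈ Literature.Geometry.Lorentzian.admissibleVacuumData X, ∃ F : EuclideanSpace ℝ (Fin 1) → Literature.Geometry.Lorentzian.InitialDataSet (𝓡 3) X, Literature.Geometry.Lorentzian.InitialDataSet.IsSmoothDataFamily 1 F ∧ F 0 = d ∧ Function.Injective F ∧ (∀ c, F c ∈ Literature.Geometry.Lorentzian.admissibleVacuumData X) ∧ ∀ c, (∃ (M a r₁ : ℝ) (hM : 0 ≤ M) (T : ℝ → ℝ) (φ : Literature.Geometry.Lorentzian.Kerr.slice a r₁ → X) (ψ : Literature.Geometry.Lorentzian.Kerr.slice a r₁ → Literature.Geometry.Lorentzian.Kerr.region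 a r₁) (ν : Literature.Geometry.Lorentzian.NormalField 𝓘(ℝ, Literature.Geometry.Lorentzian.E4) ψ), |a| < M ∧ Literature.Geometry.Lorentzian.Kerr.rMinus M a < r₁ ∧ r₁ < Literature.Geometry.Lorentzian.Kerr.rPlus M a ∧ T = (fun r : ℝ => Real.smoothTransition (r / (4 * M) - 1) * (((M) / Real.sqrt ((M) ^ 2 - (a) ^ 2)) * (Literature.Geometry.Lorentzian.Kerr.rPlus M a * Real.log (r - Literature.Geometry.Lorentzian.Kerr.rPlus M a) - Literature.Geometry.Lorentzian.Kerr.rMinus M a * Real.log (r - Literature.Geometry.Lorentzian.Kerr.rMinus M a)) - ((M) / Real.sqrt ((M) ^ 2 - (a) ^ 2)) * (Literature.Geometry.Lorentzian.Kerr.rPlus M a * Real.log ((4 * M) - Literature.Geometry.Lorentzian.Kerr.rPlus M a) - Literature.Geometry.Lorentzian.Kerr.rMinus M a * Real.log ((4 * M) - Literature.Geometry.Lorentzian.Kerr.rMinus M a)))) ∧ IsCompact (Set.range φ)ᶜ ∧ Topology.IsOpenEmbedding φ ∧ ContMDiff 𝓘(ℝ, Literature.Geometry.Lorentzian.E3)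 (𝓡 3) ((⊤ : ℕ∞) : WithTop ℕ∞) φ ∧ (∀ y : Literature.Geometry.Lorentzian.Kerr.slice a r₁, (ψ y : Literature.Geometry.Lorentzian.E4) = Literature.Geometry.Lorentzian.E4.ofTimeSpace (T (Literature.Geometry.Lorentzian.Kerr.radius a (Literature.Geometry.Lorentzian.E4.ofTimeSpace 0 (y : Literature.Geometry.Lorentzian.E3)))) (y : Literature.Geometry.Lorentzian.E3)) ∧ (Literature.Geometry.Lorentzian.Kerr.smoothMetric M a r₁).IsSpacelikeImmersion 𝓘(ℝ, Literature.Geometry.Lorentzian.E3) ψ ∧ (Literature.Geometry.Lorentzian.Kerr.smoothMetric M a r₁).IsFutureUnitNormal 𝓘(ℝ, Literature.Geometry.Lorentzian.E3) ((Literature.Geometry.Lorentzian.Kerr.timeOrientation M a r₁ hM).ofLE le_top) ψ ν ∧ (∀ y : Literature.Geometry.Lorentzian.Kerr.slice a r₁, Literature.Geometry.Lorentzian.pullbackBilin (I := 𝓡 3) (I' := 𝓘(ℝ, Literature.Geometry.Lorentzian.E3)) φ (F c).h.inner y = Literature.Geometry.Lorentzian.pullbackBilin (I := 𝓘(ℝ,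 Literature.Geometry.Lorentzian.E4)) (I' := 𝓘(ℝ, Literature.Geometry.Lorentzian.E3)) ψ (Literature.Geometry.Lorentzian.Kerr.smoothMetric M a r₁).val y) ∧ (∀ [(Literature.Geometry.Lorentzian.Kerr.smoothMetric M a r₁).HasLeviCivita] (y : Literature.Geometry.Lorentzian.Kerr.slice a r₁), (Literature.Geometry.Lorentzian.pullbackBilin (I := 𝓡 3) (I' := 𝓘(ℝ, Literature.Geometry.Lorentzian.E3)) φ (F c).k y).toLinearMap₁₂ = (Literature.Geometry.Lorentzian.Kerr.smoothMetric M a r₁).secondFundamentalForm 𝓘(ℝ, Literature.Geometry.Lorentzian.E3) ψ ν y))) := by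
  intro h
  haveI : Kerr.Facts :=
    ⟨Kerr.isConnected_region_holds, Kerr.contMDiff_bilin_holds, Kerr.contMDiff_timeVector_holds⟩
  obtain ⟨F, -, h0, -, -, hS⟩ :=
    h Minkowski.slice trivialData trivialData_mem_admissibleVacuumData
  have h1 := hS 0
  rw [h0] at h1
  exact not_kerrShielded_of_isTimeSymmetric trivialData_isTimeSymmetric h1

end Summit.FinalStateConjecture.FinalStateConjecture.Theorems.ParametricKerrBurial.Negative

end
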